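import Summits.Ventures.Crystal3D.Theorems.StickyWulffConstantGenericWallFloorInPlaneStep
import Summits.Ventures.Crystal3D.Theorems.StickyWulffConstantGenericWallFloorLineRise
import HarnessLib

/-!
# The coherent walker's menu: pay within contact distance 1, or twelve admissible moves

HONEST FRAMING. Venture `Summits/Ventures/Crystal3D` (cell `crystal3d-full`), helper for the crux
`GenericWallFloor` (stmt-Ventures-19480) of `route-Ventures-StickyWulffConstant`, REGISTERED line `WallLedgerG`,
open stub `stub_twoSlabAdhesion` (general fillings; architecture memo LINES-FLOOR-ARCH v4 = «coherent walks in
tubes», evidence on the item).  Rung credit only; F-C1 not moved.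

`walk_moves` packages `…DozenStep`, `…LineRise`, `…InPlaneStep` into the single interface the tube assembly
consumes.  A STATE is a ball `y ∈ X` with a frame `F` and three linearly independent exact `F`-slot
neighbours.  At a state, EITHER some `z ∈ X` with `dist y z ≤ 1` has at most eleven contacts (the walk PAYS),
OR (fcc) all twelve slot moves `y ↦ y + F w` land on states with frame `F`, OR (twin) for a unit `{111}` normal
`n` of `F` and the twin frame `F' x = F x − 2⟪F x, n⟫ n`: the nine own moves `y + F w` (`⟪F w, n⟫ ≤ 0`) land on
states with frame `F`, the three mirror moves `y + F' w` (`⟪F w, n⟫ < 0`) land on states with frame `F'`, and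
the three far slots are empty.  Inputs `KissingGap δ`, `KissingClassification δ` BY NAME.
WHAT THIS IS NOT: not the stub; no steering / counting; F-C1 not moved.
-/

noncomputable section

namespace Summit.Ventures.Crystal3D.Theorems

open Summit.Ventures.Crystal3D Finset
open Literature.MathematicalPhysics.StatisticalMechanics (fccStacking)
open scoped InnerProductSpace

variable {X : Finset (EuclideanSpace ℝ (Fin 3))}

/-- **The walker's menu.**  See the module docstring. -/
theorem walk_moves {δ : ℝ} (hg : KissingGap δ) (hc : KissingClassification δ)
    (hX : ∀ p ∈ X, ∀ q ∈ X, p ≠ q → 1 ≤ dist p q) {y : EuclideanSpace ℝ (Fin 3)} (hy : y ∈ X)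
    (F : EuclideanSpace ℝ (Fin 3) ≃ₗᵢ[ℝ] EuclideanSpace ℝ (Fin 3)) {a b c : EuclideanSpace ℝ (Fin 3)}
    (ha : a ∈ fccSlots) (hb : b ∈ fccSlots) (hc' : c ∈ fccSlots) (hind : LinearIndependent ℝ ![a, b, c])
    (haX : y + F a ∈ X) (hbX : y + F b ∈ X) (hcX : y + F c ∈ X) :
    (∃ z ∈ X, dist y z ≤ 1 ∧ (X.filter fun q => dist z q = 1).card ≤ 11) ∨
    (∀ w ∈ fccSlots, y + F w ∈ X ∧ ∃ a' ∈ fccSlots, ∃ b' ∈ fccSlots, ∃ c' ∈ fccSlots,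
      LinearIndependent ℝ ![a', b', c'] ∧ y + F w + F a' ∈ X ∧ y + F w + F b' ∈ X ∧ y + F w + F c' ∈ X) ∨
    ∃ n : EuclideanSpace ℝ (Fin 3), ‖n‖ = 1 ∧
      (∀ w ∈ fccSlots, ⟪F w, n⟫_ℝ = 0 ∨ ⟪F w, n⟫_ℝ = Real.sqrt (2 / 3) ∨ ⟪F w, n⟫_ℝ = -Real.sqrt (2 / 3)) ∧
      ∃ F' : EuclideanSpace ℝ (Fin 3) ≃ₗᵢ[ℝ] EuclideanSpace ℝ (Fin 3),
        (∀ x, F' x = F x - (2 * ⟪F x, n⟫_ℝ) • n) ∧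
        (∀ w ∈ fccSlots, ⟪F w, n⟫_ℝ ≤ 0 → y + F w ∈ X ∧ ∃ a' ∈ fccSlots, ∃ b' ∈ fccSlots, ∃ c' ∈ fccSlots,
          LinearIndependent ℝ ![a', b', c'] ∧ y + F w + F a' ∈ X ∧ y + F w + F b' ∈ X ∧ y + F w + F c' ∈ X) ∧
        (∀ w ∈ fccSlots, ⟪F w, n⟫_ℝ < 0 → y + F' w ∈ X ∧ ∃ a' ∈ fccSlots, ∃ b' ∈ fccSlots, ∃ c' ∈ fccSlots,
          LinearIndependent ℝ ![a', b', c'] ∧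
          y + F' w + F' a' ∈ X ∧ y + F' w + F' b' ∈ X ∧ y + F' w + F' c' ∈ X) ∧
        (∀ w ∈ fccSlots, 0 < ⟪F w, n⟫_ℝ → y + F w ∉ X) := by
  rcases line_step hg hc hX hy F ha hb hc' hind haX hbX hcX with hpay | hfull | htwin
  · exact Or.inl hpay
  · right; left
    intro w hw
    exact ⟨hfull w hw, exists_exact_neighbours_fcc_step F hy hfull hw⟩
  · right; right
    obtain ⟨n, hn, hmenu, hown, hmirror, hfar, -, -, -⟩ := htwin
    obtain ⟨F', hF'⟩ := exists_twinFrame F hn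
    refine ⟨n, hn, hmenu, F', hF', ?_, ?_, hfar⟩
    · intro w hw hle
      refine ⟨hown w hw hle, ?_⟩
      rcases lt_or_eq_of_le hle with hlt | heq
      · exact exists_exact_neighbours_nearPolar_step F hy hmenu hown hw hlt
      · exact exists_exact_neighbours_inPlane_step F hy hn hmenu hown hw heq
    · intro w hw hlt
      refine ⟨?_, exists_exact_neighbours_twin_step F F' hy hn hmenu hown hmirror hF' hw hlt⟩
      rw [hF']; exact hmirror w hw hlt

end Summit.Ventures.Crystal3D.Theorems

end
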